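/-
Origin: expansion seat `planner-pub-hodgecm-toy2-g6-0`, handover #4 2026-08-18T11:14:16Z (49226a1c 72 l.; RUN 29 additive leaf; after #3; rewrite import Toy2g6.FactorActDescent -> HodgeCM.Proofs.Pohlmann.FactorActDescent x1) (`HOME/pub-hodgecm-toy2-g6/lean/Toy2g6/ToyProdSection.lean`, md5 49226a1c, 72 lines);
landed by the gen-8 packager in gate run 29 as `HodgeCM/Model/Toy/ToyProdSection.lean` (import ^import Toy2g6\.FactorActDescent[ \t]*$→import HodgeCM.Proofs.Pohlmann.FactorActDescent ×1).
-/
/-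
Copyright: pub-hodgecm cell (HodgeCMPerL). Consistency-witness layer (part (e)); FACTS.md §1c row F2 (= M35), column P5,
and the toy witness of the new candidate `Universe.Fact_prodSection`.
Origin: HOME/pub-hodgecm-toy2-g6/lean/Toy2g6/ToyProdSection.lean (WIP module `Toy2g6.ToyProdSection`; intended final place
`HodgeCM/Model/Toy/ToyProdSection.lean` = module `HodgeCM.Model.Toy.ToyProdSection`, CONTRIBUTING §3 kind L5; the WIP import
`Toy2g6.FactorActDescent` becomes `HodgeCM.Proofs.Pohlmann.FactorActDescent`) (seat planner-pub-hodgecm-toy2-g6-0, CONSISTENCY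
seat 2 (6a)(ii) gen 6).
-/
import Summits.HodgeConjecture.HodgeCM.Proofs.Pohlmann.FactorActDescent_2
import Summits.HodgeConjecture.HodgeCM.Model.Toy.Toy
import Summits.HodgeConjecture.HodgeCM.Model.Toy.CupFacts

/-!
# `Fact_prodSection` holds in the exterior CM-model; F2 there is a corollary

In `toyModelWith D` (any Hodge datum `D`) a morphism `X ⟶ Y` is a Hodge `ℚ`-linear map `L Y → L X` of the
`H¹`-lattices, the product is the disjoint union of atom families (`L (X × Y) = L X ⊕ L Y`), and the universal
morphism `Obj.lift f g : Z ⟶ X × Y` with `lift f g ; pr_X = f`, `lift f g ; pr_Y = g` is available for every pair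
(`Objects.lean`, M18 `fact_lift`).  The ZERO map of lattices is Hodge, so `0 : X ⟶ Y` is a morphism (the toy
"constant map"), and

  `s := lift (id_X) 0 : X ⟶ X × Y`,  `s' := lift 0 (id_Y) : Y ⟶ X × Y`

are sections of the two projections ON THE NOSE: `Toy.fact_prodSection : (toyModelWith D).Fact_prodSection`.

Consequences.
* The enlarged candidate list keeps its kernel-checked consistency witness: `toyModel` satisfies
  `ModelAxioms ∧ N1 ∧ N3 ∧ Fact_prodSection` (`toyModel_fact_prodSection` with `toyModel_modelAxioms`,
  `toyModel_fact_cupExterior`, `toyModel_fact_pull_H0`).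
* F2 = M35 `Fact_factorActDescends` holds in `toyModel` AS A COROLLARY of the model-independent derivation
  `Universe.fact_factorActDescends_of_prodSection` (`Proofs/Pohlmann/FactorActDescent.lean`):
  `toyModel_fact_factorActDescends_of_prodSection`.  (The direct toy proof `Toy.fact_factorActDescends`,
  `Model/Toy/ToyF2.lean`, run 23, is untouched; the two are independent checks of the same row.)
* FACTS.md §1c row F2, column P5: NO separating model is filed, and none exists among universes with product
  sections: F2 is REDUNDANT given `ModelAxioms` (M1–M3, M18, M21 used) + N1 + N3 + `Fact_prodSection`.
-/

namespace HodgeCM.Toy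

open Literature.AlgebraicGeometry.Motives

noncomputable section

variable (D : HodgeData)

/-- the zero map of `H¹`-lattices is Hodge (it kills `F¹`) -/
private lemma isHodge_zero_lin (X Y : Obj) : Obj.IsHodge (X := X) (Y := Y) (0 : Y.L →ₗ[ℚ] X.L) := by
  unfold Obj.IsHodge
  rw [LinearMap.baseChange_zero, Submodule.map_zero]
  exact bot_le

/-- **`Fact_prodSection` in the exterior model**: `lift id 0` and `lift 0 id` are sections of `pr_X`, `pr_Y`. -/
theorem fact_prodSection : (toyModelWith D).Fact_prodSection := fun X Y =>
  ⟨⟨Obj.lift (Obj.Hom.id X) ⟨0, isHodge_zero_lin X Y⟩, Obj.lift_comp_fst _ _⟩,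
    ⟨Obj.lift ⟨0, isHodge_zero_lin Y X⟩ (Obj.Hom.id Y), Obj.lift_comp_snd _ _⟩⟩

/-- … in particular in `toyModel`. -/
theorem toyModel_fact_prodSection : toyModel.Fact_prodSection := fact_prodSection exteriorHodgeData

/-- **F2 in `toyModel` as a corollary of the derivation** `fact_factorActDescends_of_prodSection`. -/
theorem toyModel_fact_factorActDescends_of_prodSection : toyModel.Fact_factorActDescends :=
  Universe.fact_factorActDescends_of_prodSection toyModel_modelAxioms toyModel_fact_cupExterior
    toyModel_fact_pull_H0 toyModel_fact_prodSection

/-- The enlarged list `ModelAxioms ∧ N1 ∧ N3 ∧ Fact_prodSection` is consistent (witness `toyModel`). -/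
theorem modelAxioms_prodSection_consistent :
    ∃ U : Universe, U.ModelAxioms ∧ U.Fact_cupExterior ∧ U.Fact_pull_H0 ∧ U.Fact_prodSection :=
  ⟨toyModel, toyModel_modelAxioms, toyModel_fact_cupExterior, toyModel_fact_pull_H0, toyModel_fact_prodSection⟩

end

end HodgeCM.Toy
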